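import Summits.QuantumFields.YangMills.Statement
import Summits.QuantumFields.YangMills.Theorems.EquipartitionCriticalityEquipartitionPinsProbe
import Summits.QuantumFields.YangMills.Theorems.EquipartitionCriticalityFreeEnergyLogCoefficient
import Summits.QuantumFields.YangMills.Theorems.EquipartitionCriticalityRPProbeCriticality
import Literature.MathematicalPhysics.QuantumLattice.LatticeGaugeDLR
import Literature.MathematicalPhysics.QuantumLattice.LatticeGaugeDLRLimitPointsProofs
import Literature.MathematicalPhysics.QuantumLattice.LatticeGaugeDLRGibbsProofs
import Literature.MathematicalPhysics.QuantumLattice.WilsonLoops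
import Literature.MathematicalPhysics.QuantumLattice.WilsonLoopsProofs
import Literature.MathematicalPhysics.QuantumLattice.ContinuumLimitLGT
import Literature.MathematicalPhysics.QuantumLattice.GaugeGroups
import Literature.MathematicalPhysics.QuantumLattice.GaugeGroupsProofs
import Literature.MathematicalPhysics.QuantumLattice.RepLieAlgebraUnitary
import Literature.MathematicalPhysics.QuantumFieldTheory.YangMillsOS
import Literature.MathematicalPhysics.QuantumFieldTheory.CurvatureGaussianField
import Literature.MathematicalPhysics.QuantumFieldTheory.LatticeAxialGauge
import HarnessLib

/-!
# Weak-coupling RATES below the Clay horizon — the RP-spectral mass-gap currency, the rung leaves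
# `XiPowSU2` / `XiPow` («every lattice gap is `≤ β^{-ε}`»), and their kernel glue

HONEST FRAMING (cell `ym-beyond`, seat P3 «lower the summit honestly», HUMAN RULINGS D-0035 / D-0059 / D-0061; memo of
record `run/shared/lean/pub/ym-beyond/ROUTE-P3.md` v9 §12–§13, sketch `ROUTE-P3-Sketch.lean` v9 §I, §J, farm rc 0; filed for
the cell by its courier / lit seat).  EVERYTHING HERE IS BELOW THE SUMMIT AND SAYS SO: the two `@[conjecture]` leaves are UPPER
bounds on the lattice mass gap of the infinite-volume Wilson states at weak coupling (equivalently LOWER bounds on the correlation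
length in lattice units), i.e. the trivial half of asymptotic scaling.  They are registered so that a LEDGER ROUTE can `closes` them as
RUNG LEAVES (D-0061: «closes rung R2a/R1-rates of QuantumFields», class rung, never summit credit).  WHAT THIS IS NOT: not the Clay
mass gap (`m > 0`), not confinement, not a continuum limit; nothing here bounds a gap from below.

CONTENTS (all `sorry`-free; axioms = the standard trio).
* §1 The RP-spectral currency on `ℤ^d` configurations: site time-reflection `timeReflectLG`, time shift `timeShiftLG`
  (= the tree's `configShift (−t e₀)`), positive-time observables `IsPosTimeObs`, the reflection-positivity correlator `rpCorr`,
  and `HasRPTimeGap μ m` («`⟨θF·α_tF⟩ − ⟨θF⟩⟨α_tF⟩ ≤ e^{−mt}(⟨θF·F⟩ − ⟨θF⟩⟨F⟩)` for every positive-time `F`», which every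
  transfer-matrix spectral gap `≥ m` of an OS-reconstructed translation-invariant RP state gives); the one-distance bound
  `HasRPTimeGap.le_log_div` (`m ≤ log(V/δ)/t`).
* §2 The targets over the tree's `infiniteVolumeLimitPoints ρ β` (torus-limit states): `MassGapUpperRateOf d ρ r` (XI-RATE),
  `MassGapVanishesOf d ρ` (XI-DIV, Chatterjee 2019 Problem 5.1 second half «`ξ(β) → ∞`»), `MassGapPowerDecayOf d ρ ε` (XI-POW).
* §3 The torus-side node `UniformTorusPlaquetteCorr` (PW-CORR: a volume-uniform LOWER bound on the connected plaquette–plaquette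
  correlator at one time separation) and the KERNEL GLUE, proved: PW-CORR ⇒ XI-RATE (`massGapUpperRateOf_of_uniformTorusPlaquetteCorr`),
  power law at polynomial separation ⇒ XI-POW (`massGapPowerDecayOf_of_powerLawCorr`, `PolySeparationPlaquetteFloor`,
  `massGapPowerDecayOf_of_polySeparationFloor`).
* §4 PROVED RUNG: XI-DIV for EVERY compact simple `G` in `d = 4` (`massGapVanishesOf_allSimpleG`), from the tree's
  `EquipartitionPinsProbe_proof ∘ freeEnergyLogCoefficient_proof` (route `EquipartitionCriticality`, items 8759/8760) by translation
  invariance of torus-limit states (`integral_comp_configShift_of_mem_limitPoints`) and the two-time form of the spectral bound.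
* §5 The CLEAN-BOX SPLIT of PW-CORR-POLY (the route's typed cruxes): the cold-wall box state `boxState` (the tree's
  `ymSpecification` on the edges of `[0,2H]⁴` with flat boundary datum), `boxPlaqCov` / `torusPlaqCov`, and the three named inputs
  `BoxTwoPointDomination` (Gaussian domination of the two-plaquette covariance in a cold box of side `⌈β^θ⌉` at separation `⌈β^A⌉`),
  `BulkDominatesBox` (the torus states dominate a fixed fraction of the box covariance, uniformly in the volume — the infinite-volume
  content); the third input FLOOR (`κ/n⁴ ≤ |c_n|` for the tree's lattice-Maxwell plaquette two-point number `curvaturePlaquetteCorr 4 n`;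
  the statement of stub F1 of `Cruxes/SofteningCentreBlind/Lines/birth.lean`) is written inline; glue PROVED:
  `polySeparationPlaquetteFloor_of_box`, `massGapPowerDecayOf_of_box`.
* §6 The rung NODES: `XiDiv` (XI-DIV for every compact simple `G` — PROVED, `xiDiv_holds`), and the LEAVES `XiPowSU2` (`∃ ε > 0`, every
  torus-limit state of 4-D `SU(2)` Wilson theory has RP-spectral gap `≤ β^{-ε}` for `β ≥ β₀`) and `XiPow` (the same for every compact
  simple `G` and faithful unitary `r`), tagged `@[conjecture]` (OPEN; NOT claimed), with the proved glue
  `xiPowSU2_of_box : BOX → BULK → FLOOR → XiPowSU2` and `xiPowSU2_of_xiPow : XiPow → XiPowSU2`.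

References: S. Chatterjee, *Yang–Mills for probabilists*, arXiv:1803.01950, Problem 5.1 [ChatterjeeYMProb2019]; S. Chatterjee, J. Funct.
Anal. 271 (2016), arXiv:1602.01222 [arXiv160201222]; K. Osterwalder, E. Seiler, Ann. Phys. 110 (1978) 440 [OsterwalderSeiler1978];
E. Seiler, LNP 159 (1982) [SeilerLNP1982]; T. Bałaban, CMP 122 (1989) 175 / 355 [Balaban1989LargeFieldI, Balaban1989LargeFieldII];
G. Lawler, *Intersections of random walks* (1991) Thm 1.5.5 [Lawler1991]; G. Lawler, V. Limic, *Random walk: a modern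
introduction* (2010) §4.3 [LawlerLimic2010]; C. Garban, A. Sepúlveda, IMRN 2023 [GarbanSepulveda2023].

FILING NOTE (courier). Filed for the cell by its courier seat (ym-beyond-courier g2) VERBATIM from `run/shared/lean/pub/ym-
beyond/LIFT-P3-WeakCouplingRates.lean` (sha16 d721fbe54c9c8af9, author P3 g9), re-partitioned into THREE tree modules because
Theorems files are capped at 400 lines (gate `lint.size`): `WeakCouplingRatesCurrency` = §1–§3, `WeakCouplingRatesRung` = §4,
`WeakCouplingRates` = §5–§6, import chain 1 → 2 → 3, ONE namespace `Summit.QuantumFields.YangMills.Theorems.WeakCouplingRates`,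
every declaration byte-identical and in source order.  Courier deltas, exhaustively: this note; the short module docstrings of parts
2–3; the re-opened `section` / `variable` preambles of parts 2–3 (copies of the source lines 65–80 and 180); three one-line
docstrings demanded by `lint.docstring` (on `timeShiftLG_zero`, `continuous_bounded_plaqCost0`,
`massGapPowerDecayOf_of_polySeparationFloor`).  No mathematics added, no statement changed.
-/

set_option autoImplicit false

noncomputable section

open MeasureTheory Filter Topology
open Literature.MathematicalPhysics
open Literature.MathematicalPhysics.QuantumFieldTheory
open Literature.MathematicalPhysics.QuantumLattice
open Summit.QuantumFields.YangMills.Theorems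

namespace Summit.QuantumFields.YangMills.Theorems.WeakCouplingRates

section Currency

variable {d N : ℕ} {G : Type*} [Group G] [TopologicalSpace G] [IsTopologicalGroup G] [CompactSpace G]
  [MeasurableSpace G] [BorelSpace G]

/-! ### §1. Time reflection, time shift, the RP-spectral gap of a state on `ℤ^d` -/

/-- Site time-reflection `r : (x₀, x⃗) ↦ (−x₀, x⃗)` of `ℤ^d`. -/
def trSite [NeZero d] (x : Literature.Probability.LatticeModels.Site d) : Literature.Probability.LatticeModels.Site d :=
  Function.update x 0 (-x 0)

/-- Time reflection `θ` of a gauge configuration on `ℤ^d` through the site hyperplane `x₀ = 0`: a spatial link `(x, i)`, `i ≠ 0`,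
is read at the reflected site; the temporal link `(x, 0)` goes to the REVERSED temporal link from `r x − e₀` to `r x`
(Osterwalder–Seiler 1978 §2; Seiler LNP 159 Ch. 5). -/
def timeReflectLG [NeZero d] (U : LGConfig d G) : LGConfig d G := fun e =>
  if e.2 = 0 then (U (trSite e.1 - Pi.single 0 1, 0))⁻¹ else U (trSite e.1, e.2)

/-- Time shift by `t`: `(α_t U)(x, i) = U(x + t e₀, i)` (the tree's `configShift (−t e₀)`). -/
abbrev timeShiftLG [NeZero d] (t : ℕ) : LGConfig d G ≃ᵐ LGConfig d G :=
  configShift (-(Pi.single 0 (t : ℤ)))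

/-- Observables of the closed positive-time half `{x₀ ≥ 0}`: bounded continuous cylinder functions all of whose supporting edges
are based at sites with `x₀ ≥ 0`. -/
structure IsPosTimeObs [NeZero d] (F : LGConfig d G → ℝ) : Prop where
  cyl : ∃ S : Finset (QuantumLattice.ZdEdge d), IsCylinder F S ∧ ∀ e ∈ S, 0 ≤ e.1 0
  cont : Continuous F
  bdd : ∃ C, ∀ U, |F U| ≤ C

/-- The reflection-positivity correlator `⟨θF · α_t F⟩_μ − ⟨θF⟩_μ ⟨α_t F⟩_μ`. -/
def rpCorr [NeZero d] (μ : Measure (LGConfig d G)) (F : LGConfig d G → ℝ) (t : ℕ) : ℝ :=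
  (∫ U, F (timeReflectLG U) * F (timeShiftLG (G := G) t U) ∂μ) -
    (∫ U, F (timeReflectLG U) ∂μ) * (∫ U, F (timeShiftLG (G := G) t U) ∂μ)

/-- **`μ` has RP-spectral (transfer-matrix) mass gap `≥ m`**: `m > 0` and for every positive-time observable `F` and every `t`,
`⟨θF·α_tF⟩ − ⟨θF⟩⟨α_tF⟩ ≤ e^{−m t} (⟨θF·F⟩ − ⟨θF⟩⟨F⟩)` — what a spectral gap `spec(H) ∩ (0, m) = ∅` of the transfer Hamiltonian of
an OS-reconstructed, reflection-positive, translation-invariant state gives (`⟨v, T^t v⟩ ≤ ‖T|_{Ω^⊥}‖^t ‖v‖²`).  An upper bound on every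
such `m` is an upper bound on the physical mass gap / a lower bound on `ξ = 1/m`. -/
def HasRPTimeGap [NeZero d] (μ : Measure (LGConfig d G)) (m : ℝ) : Prop :=
  0 < m ∧ ∀ F : LGConfig d G → ℝ, IsPosTimeObs F →
    ∀ t : ℕ, rpCorr μ F t ≤ Real.exp (-(m * t)) * rpCorr μ F 0

omit [IsTopologicalGroup G] [CompactSpace G] [BorelSpace G] in
/-- **The one-distance spectral bound.** A gap `m` and ONE positive-time observable whose RP correlator at time `t ≥ 1` is at least
`δ > 0` while its `t = 0` value is at most `V` force `m ≤ log(V/δ)/t`. -/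
theorem HasRPTimeGap.le_log_div [NeZero d] {μ : Measure (LGConfig d G)} {m : ℝ} (h : HasRPTimeGap μ m)
    {F : LGConfig d G → ℝ} (hF : IsPosTimeObs F) {t : ℕ} (ht : 1 ≤ t) {δ V : ℝ} (hδ : 0 < δ)
    (hδle : δ ≤ rpCorr μ F t) (hV : rpCorr μ F 0 ≤ V) : m ≤ Real.log (V / δ) / t := by
  have hgap := h.2 F hF t
  have hexp : 0 < Real.exp (-(m * t)) := Real.exp_pos _
  have h1 : δ ≤ Real.exp (-(m * t)) * V :=
    hδle.trans (hgap.trans (mul_le_mul_of_nonneg_left hV hexp.le))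
  have hV0 : 0 < V := by
    rcases lt_or_ge 0 V with hV0 | hV0
    · exact hV0
    · have : Real.exp (-(m * t)) * V ≤ 0 := mul_nonpos_of_nonneg_of_nonpos hexp.le hV0
      linarith
  have ht0 : (0 : ℝ) < t := by exact_mod_cast ht
  have h2 : Real.log δ ≤ -(m * t) + Real.log V := by
    have := Real.log_le_log hδ h1
    rwa [Real.log_mul hexp.ne' hV0.ne', Real.log_exp] at this
  rw [le_div_iff₀ ht0, Real.log_div hV0.ne' hδ.ne']
  linarith

omit [TopologicalSpace G] [IsTopologicalGroup G] [CompactSpace G] [MeasurableSpace G] [BorelSpace G] in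
/-- A cylinder observable supported on SPATIAL links in the time-zero hyperplane is `θ`-invariant. -/
theorem comp_timeReflectLG_eq [NeZero d] {F : LGConfig d G → ℝ} {S : Finset (QuantumLattice.ZdEdge d)} (hF : IsCylinder F S)
    (hS : ∀ e ∈ S, e.1 0 = 0 ∧ e.2 ≠ 0) (U : LGConfig d G) : F (timeReflectLG U) = F U := by
  refine hF (fun e he => ?_)
  obtain ⟨h0, hne⟩ := hS e (by simpa using he)
  have htr : trSite e.1 = e.1 := by
    rw [trSite, h0, neg_zero]
    exact Function.update_eq_self_iff.2 h0.symm
  obtain ⟨x, k⟩ := e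
  simp only at hne htr
  simp [timeReflectLG, hne, htr]

omit [Group G] [TopologicalSpace G] [IsTopologicalGroup G] [CompactSpace G] [BorelSpace G] in
/-- Time shift of a cylinder observable is a cylinder observable on the shifted support. -/
theorem isCylinder_timeShift [NeZero d] {F : LGConfig d G → ℝ} {S : Finset (QuantumLattice.ZdEdge d)} (hF : IsCylinder F S)
    (t : ℕ) :
    IsCylinder (fun U => F (timeShiftLG (G := G) t U))
      (S.image fun e => (e.1 + Pi.single 0 (t : ℤ), e.2)) := by
  intro U V hUV
  refine hF (fun e he => ?_)
  simp only [timeShiftLG, configShift_apply]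
  exact hUV _ (by
    rw [Finset.coe_image]
    exact ⟨e, he, by simp⟩)

omit [Group G] [IsTopologicalGroup G] [CompactSpace G] [BorelSpace G] in
/-- The time shift is continuous (product topology). -/
theorem continuous_timeShiftLG [NeZero d] (t : ℕ) : Continuous (timeShiftLG (d := d) (G := G) t) := by
  refine continuous_pi fun e => ?_
  simp only [timeShiftLG, configShift_apply]
  exact continuous_apply _

omit [Group G] [TopologicalSpace G] [IsTopologicalGroup G] [CompactSpace G] [BorelSpace G] in
/-- `α_0 = id`: the time shift by `0` is the identity. -/
@[simp] theorem timeShiftLG_zero [NeZero d] (U : LGConfig d G) : timeShiftLG (G := G) 0 U = U := by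
  ext e
  simp [timeShiftLG, configShift_apply]

/-! ### §2. The targets: an upper RATE for the mass gap of every torus-limit state -/

variable (ρ : G →* Matrix (Fin N) (Fin N) ℂ)

/-- **XI-RATE(r)** — «for `β ≥ β₀`, every infinite-volume torus-limit state of the Wilson theory (model `ρ`) has RP-spectral mass
gap at most `r(β)`» (lattice units).  NOT THE CLAY GAP: an UPPER bound on the gap. -/
def MassGapUpperRateOf (d : ℕ) [NeZero d] (ρ : G →* Matrix (Fin N) (Fin N) ℂ) (r : ℝ → ℝ) : Prop :=
  ∃ β₀ : ℝ, ∀ β : ℝ, β₀ ≤ β → ∀ μ ∈ infiniteVolumeLimitPoints (d := d) ρ β,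
    ∀ m : ℝ, HasRPTimeGap μ m → m ≤ r β

/-- **XI-DIV** — «the correlation length diverges as `β → ∞`»: for every `ε > 0`, for all large `β`, no torus-limit state has an
RP-spectral gap larger than `ε` (Chatterjee 2019 Problem 5.1, second half, for the torus-limit states).  NOT THE CLAY GAP. -/
def MassGapVanishesOf (d : ℕ) [NeZero d] (ρ : G →* Matrix (Fin N) (Fin N) ℂ) : Prop :=
  ∀ ε : ℝ, 0 < ε → MassGapUpperRateOf d ρ (fun _ => ε)

/-- Monotonicity of XI-RATE in the rate (eventual domination suffices). -/
theorem massGapUpperRateOf_mono [NeZero d] {r₁ r₂ : ℝ → ℝ} (h12 : ∀ᶠ β : ℝ in atTop, r₁ β ≤ r₂ β)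
    (h : MassGapUpperRateOf d ρ r₁) : MassGapUpperRateOf d ρ r₂ := by
  obtain ⟨β₀, hβ₀⟩ := h
  obtain ⟨β₁, hβ₁⟩ := eventually_atTop.1 h12
  exact ⟨max β₀ β₁, fun β hβ μ hμ m hm =>
    (hβ₀ β ((le_max_left _ _).trans hβ) μ hμ m hm).trans (hβ₁ β ((le_max_right _ _).trans hβ))⟩

/-- **XI-POW(ε)** — «for `β ≥ β₀` every infinite-volume torus-limit state has RP-spectral mass gap at most `β^{-ε}`» (lattice units):
a POWER-LAW rate for criticality.  Asymptotic freedom predicts `m(β) ≍ β^{c₁} e^{-c₂ β}`, so XI-POW is far from sharp; its content is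
that the Gaussian (free-gluon) regime provably extends to separations `β^{ε'}` in infinite volume.  NOT THE CLAY GAP. -/
def MassGapPowerDecayOf (d : ℕ) [NeZero d] (ρ : G →* Matrix (Fin N) (Fin N) ℂ) (ε : ℝ) : Prop :=
  MassGapUpperRateOf d ρ (fun β => β ^ (-ε))

/-! ### §3. The torus-side node PW-CORR and the kernel glue -/

/-- The plaquette COST `N − Re tr ρ(U_p)` of the plaquette based at the origin in the `(i, j)` plane, on `ℤ^d` configurations. -/
def plaqCost0 (i j : Fin d) : LGConfig d G → ℝ := fun U => (N : ℝ) - plaquetteObs ρ 0 i j U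

/-- **PW-CORR(T, δ)** — «a volume-uniform LOWER bound on the connected plaquette–plaquette correlator of the torus Wilson states at time
separation `T(β)`»: for `β ≥ β₀` and all large tori `Λ_{L+1}`, `⟨c_p · c_{p + T(β)e₀}⟩ − ⟨c_p⟩⟨c_{p+T(β)e₀}⟩ ≥ δ(β)` for the plaquette `p`
at the origin of the `(i, j)` plane (`c = N − Re tr ρ(U_p)`, observables read through the periodic lift).  The content is the
UNIFORMITY IN `L`.  NOT in print. -/
def UniformTorusPlaquetteCorr (d : ℕ) [NeZero d] (ρ : G →* Matrix (Fin N) (Fin N) ℂ) (i j : Fin d)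
    (T : ℝ → ℕ) (δ : ℝ → ℝ) : Prop :=
  ∃ β₀ : ℝ, ∀ β : ℝ, β₀ ≤ β → ∀ᶠ L : ℕ in atTop,
    δ β ≤
      wilsonExpectation (L := L + 1) ρ β
          (toTorusObservable (L + 1) fun U => plaqCost0 ρ i j U * plaqCost0 ρ i j (timeShiftLG (G := G) (T β) U)) -
        wilsonExpectation (L := L + 1) ρ β (toTorusObservable (L + 1) (plaqCost0 ρ i j)) *
          wilsonExpectation (L := L + 1) ρ β
            (toTorusObservable (L + 1) fun U => plaqCost0 ρ i j (timeShiftLG (G := G) (T β) U))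

omit [TopologicalSpace G] [IsTopologicalGroup G] [CompactSpace G] [MeasurableSpace G] [BorelSpace G] in
/-- The origin plaquette cost in a SPATIAL plane is a time-zero spatial (hence `θ`-invariant) cylinder observable. -/
theorem plaqCost0_support [NeZero d] {i j : Fin d} (hi : i ≠ 0) (hj : j ≠ 0) :
    IsCylinder (plaqCost0 (G := G) ρ i j)
        ({((0 : Literature.Probability.LatticeModels.Site d), i), ((0 : Literature.Probability.LatticeModels.Site d) + Pi.single i 1, j),
          ((0 : Literature.Probability.LatticeModels.Site d) + Pi.single j 1, i), (0, j)} : Finset (QuantumLattice.ZdEdge d)) ∧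
      ∀ e ∈ ({((0 : Literature.Probability.LatticeModels.Site d), i), ((0 : Literature.Probability.LatticeModels.Site d) + Pi.single i 1, j),
          ((0 : Literature.Probability.LatticeModels.Site d) + Pi.single j 1, i), (0, j)} : Finset (QuantumLattice.ZdEdge d)), e.1 0 = 0 ∧ e.2 ≠ 0 := by
  refine ⟨?_, ?_⟩
  · intro U V h
    simp only [plaqCost0, plaquetteObs, plaquetteHolonomyZd]
    rw [h (0, i) (by simp), h ((0 : Literature.Probability.LatticeModels.Site d) + Pi.single i 1, j) (by simp), h ((0 : Literature.Probability.LatticeModels.Site d) + Pi.single j 1, i) (by simp),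
      h (0, j) (by simp)]
  · intro e he
    simp only [Finset.mem_insert, Finset.mem_singleton] at he
    rcases he with rfl | rfl | rfl | rfl <;> simp [hi, hj, Ne.symm hi, Ne.symm hj]

omit [MeasurableSpace G] [BorelSpace G] in
/-- For a continuous model `ρ`, the origin plaquette cost is continuous and bounded on `ℤ^d` configurations. -/
theorem continuous_bounded_plaqCost0 (hρ : Continuous ρ) (i j : Fin d) :
    Continuous (plaqCost0 (G := G) ρ i j) ∧ ∃ C, ∀ U : LGConfig d G, |plaqCost0 ρ i j U| ≤ C := by
  refine ⟨continuous_const.sub (continuous_plaquetteObs ρ hρ 0 i j), ?_⟩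
  obtain ⟨C, hC⟩ := exists_abs_plaquetteObs_le ρ hρ 0 i j
  refine ⟨(N : ℝ) + C, fun U => ?_⟩
  have h := hC U
  have hC0 : 0 ≤ C := (abs_nonneg _).trans h
  simp only [plaqCost0]
  rw [abs_le] at h ⊢
  constructor <;> nlinarith [h.1, h.2, (Nat.cast_nonneg N : (0 : ℝ) ≤ N)]

/-- **KERNEL GLUE: PW-CORR ⇒ XI-RATE.**  A volume-uniform lower bound `δ(β) > 0` on the connected plaquette two-point function of the torus
states at time separation `T(β) ≥ 1` passes to every infinite-volume limit state (weak convergence on bounded continuous cylinder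
observables), where the one-distance spectral bound gives `m ≤ log(V/δ(β))/T(β)` for every RP-spectral gap `m`. -/
theorem massGapUpperRateOf_of_uniformTorusPlaquetteCorr [NeZero d] (hρ : Continuous ρ) {i j : Fin d}
    (hi : i ≠ 0) (hj : j ≠ 0) {T : ℝ → ℕ} {δ : ℝ → ℝ} (hT : ∀ᶠ β in atTop, 1 ≤ T β)
    (hδ : ∀ᶠ β in atTop, 0 < δ β) (h : UniformTorusPlaquetteCorr d ρ i j T δ) :
    ∃ V : ℝ, 0 < V ∧ MassGapUpperRateOf d ρ (fun β => Real.log (V / δ β) / T β) := by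
  obtain ⟨hcont, C, hC⟩ := continuous_bounded_plaqCost0 ρ hρ i j
  obtain ⟨hcyl, hS⟩ := plaqCost0_support (G := G) ρ hi hj
  refine ⟨C ^ 2 + 1, by positivity, ?_⟩
  obtain ⟨β₀, hβ₀⟩ := h
  obtain ⟨β₁, hβ₁⟩ := eventually_atTop.1 (hT.and hδ)
  refine ⟨max β₀ β₁, fun β hβ μ hμ m hm => ?_⟩
  obtain ⟨hTβ, hδβ⟩ := hβ₁ β ((le_max_right _ _).trans hβ)
  set F : LGConfig d G → ℝ := plaqCost0 ρ i j with hFdef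
  have hpos : IsPosTimeObs F :=
    ⟨⟨_, hcyl, fun e he => (hS e he).1.ge⟩, hcont, C, hC⟩
  have hrefl : ∀ U : LGConfig d G, F (timeReflectLG U) = F U :=
    comp_timeReflectLG_eq hcyl hS
  obtain ⟨Lk, hmono, hprob, hlim⟩ := hμ
  haveI := hprob
  have hcylG := isCylinder_timeShift hcyl (T β)
  have hcontG : Continuous fun U => F (timeShiftLG (G := G) (T β) U) :=
    hcont.comp (continuous_timeShiftLG (T β))
  have hbdG : ∃ C, ∀ U : LGConfig d G, |F (timeShiftLG (G := G) (T β) U)| ≤ C := ⟨C, fun U => hC _⟩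
  have hbdP : ∃ C', ∀ U : LGConfig d G, |F U * F (timeShiftLG (G := G) (T β) U)| ≤ C' :=
    ⟨C * C, fun U => by
      rw [abs_mul]
      exact mul_le_mul (hC _) (hC _) (abs_nonneg _) ((abs_nonneg _).trans (hC U))⟩
  have tF := hlim F _ hcyl hcont ⟨C, hC⟩
  have tG := hlim _ _ hcylG hcontG hbdG
  have tP := hlim _ _ (IsCylinder.mul hcyl hcylG) (hcont.mul hcontG) hbdP
  have hev := hmono.tendsto_atTop.eventually (hβ₀ β ((le_max_left _ _).trans hβ))
  have hcov : δ β ≤ (∫ U, F U * F (timeShiftLG (G := G) (T β) U) ∂μ) -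
      (∫ U, F U ∂μ) * (∫ U, F (timeShiftLG (G := G) (T β) U) ∂μ) :=
    ge_of_tendsto (tP.sub (tF.mul tG)) hev
  have hcorr_t : rpCorr μ F (T β) = (∫ U, F U * F (timeShiftLG (G := G) (T β) U) ∂μ) -
      (∫ U, F U ∂μ) * (∫ U, F (timeShiftLG (G := G) (T β) U) ∂μ) := by
    simp only [rpCorr, hrefl]
  have hcorr_0 : rpCorr μ F 0 ≤ C ^ 2 + 1 := by
    simp only [rpCorr, hrefl, timeShiftLG_zero]
    have h1 : (∫ U, F U * F U ∂μ) ≤ C ^ 2 := by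
      have hb : ∀ᵐ U ∂μ, ‖F U * F U‖ ≤ C ^ 2 := ae_of_all _ fun U => by
        rw [Real.norm_eq_abs, abs_mul, sq]
        exact mul_le_mul (hC _) (hC _) (abs_nonneg _) ((abs_nonneg _).trans (hC U))
      have := norm_integral_le_of_norm_le_const hb
      rw [probReal_univ, mul_one, Real.norm_eq_abs] at this
      exact (le_abs_self _).trans this
    nlinarith [mul_self_nonneg (∫ U, F U ∂μ)]
  exact hm.le_log_div hpos hTβ hδβ (hcorr_t ▸ hcov) hcorr_0

/-- **KERNEL: PW-CORR with a power law at polynomial separation ⇒ XI-POW.**  If the connected plaquette correlator at separation `⌈β^A⌉`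
is `≥ κ β^{-a}` uniformly in the volume (`A > 0`), then `m(β) ≤ log(V β^a/κ)/β^A ≤ β^{-A/2}` eventually. -/
theorem massGapPowerDecayOf_of_powerLawCorr [NeZero d] (hρ : Continuous ρ) {i j : Fin d} (hi : i ≠ 0) (hj : j ≠ 0)
    {A a κ : ℝ} (hA : 0 < A) (hκ : 0 < κ)
    (h : UniformTorusPlaquetteCorr d ρ i j (fun β => ⌈β ^ A⌉₊) (fun β => κ * β ^ (-a))) :
    MassGapPowerDecayOf d ρ (A / 2) := by
  have hT : ∀ᶠ β : ℝ in atTop, 1 ≤ ⌈β ^ A⌉₊ := by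
    filter_upwards [eventually_gt_atTop 0] with β hβ
    exact Nat.one_le_iff_ne_zero.2 (Nat.pos_iff_ne_zero.1 (Nat.ceil_pos.2 (Real.rpow_pos_of_pos hβ A)))
  have hδ : ∀ᶠ β : ℝ in atTop, 0 < κ * β ^ (-a) := by
    filter_upwards [eventually_gt_atTop 0] with β hβ
    exact mul_pos hκ (Real.rpow_pos_of_pos hβ _)
  obtain ⟨V, hV, hrate⟩ := massGapUpperRateOf_of_uniformTorusPlaquetteCorr ρ hρ hi hj hT hδ h
  refine massGapUpperRateOf_mono ρ ?_ hrate
  have hA2 : 0 < A / 2 := by linarith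
  have hnum : Tendsto (fun β : ℝ => (Real.log (V / κ) + a * Real.log β) / β ^ (A / 2)) atTop (𝓝 0) := by
    have h1 : Tendsto (fun β : ℝ => Real.log (V / κ) / β ^ (A / 2)) atTop (𝓝 0) :=
      tendsto_const_nhds.div_atTop (tendsto_rpow_atTop hA2)
    have h2 : Tendsto (fun β : ℝ => a * (Real.log β / β ^ (A / 2))) atTop (𝓝 (a * 0)) :=
      ((isLittleO_log_rpow_atTop hA2).tendsto_div_nhds_zero).const_mul a
    rw [mul_zero] at h2
    have h3 := h1.add h2
    rw [add_zero] at h3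
    refine h3.congr (fun β => ?_)
    ring
  have hev : ∀ᶠ β : ℝ in atTop, (Real.log (V / κ) + a * Real.log β) / β ^ (A / 2) ≤ 1 :=
    (hnum.eventually (eventually_le_nhds zero_lt_one)).mono fun β h => h
  filter_upwards [hev, eventually_gt_atTop 0] with β hβ1 hβ
  have hβA : 0 < β ^ A := Real.rpow_pos_of_pos hβ A
  have hβA2 : 0 < β ^ (A / 2) := Real.rpow_pos_of_pos hβ _
  have hceil : β ^ A ≤ (⌈β ^ A⌉₊ : ℝ) := Nat.le_ceil _
  have hlog : Real.log (V / (κ * β ^ (-a))) = Real.log (V / κ) + a * Real.log β := by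
    rw [Real.rpow_neg hβ.le, ← div_div, div_inv_eq_mul,
      Real.log_mul (div_pos hV hκ).ne' (Real.rpow_pos_of_pos hβ a).ne', Real.log_rpow hβ]
  rw [hlog]
  have hnumle : Real.log (V / κ) + a * Real.log β ≤ β ^ (A / 2) := (div_le_one hβA2).1 hβ1
  have htarget : β ^ (A / 2) / β ^ A = β ^ (-(A / 2)) := by
    rw [← Real.rpow_sub hβ]
    congr 1
    ring
  rcases le_or_gt 0 (Real.log (V / κ) + a * Real.log β) with hpos | hneg
  · calc (Real.log (V / κ) + a * Real.log β) / (⌈β ^ A⌉₊ : ℝ)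
        ≤ (Real.log (V / κ) + a * Real.log β) / β ^ A :=
          div_le_div_of_nonneg_left hpos hβA hceil
      _ ≤ β ^ (A / 2) / β ^ A := div_le_div_of_nonneg_right hnumle hβA.le
      _ = β ^ (-(A / 2)) := htarget
  · have h0 : (Real.log (V / κ) + a * Real.log β) / (⌈β ^ A⌉₊ : ℝ) ≤ 0 :=
      div_nonpos_of_nonpos_of_nonneg hneg.le (Nat.cast_nonneg _)
    exact h0.trans (Real.rpow_nonneg hβ.le _)

/-- **PW-CORR-POLY(A, κ)** — the torus-side target in the shape the weak-coupling engines produce: a power-law floor `κ β^{-(2+8A)}` under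
the connected plaquette–plaquette correlator at time separation `⌈β^A⌉`, volume-uniformly (free two-gluon exchange: `β² Cov ≍ c_n² ≍ n^{-8}`
at separation `n`).  NOT in print; NOT THE CLAY GAP. -/
def PolySeparationPlaquetteFloor (d : ℕ) [NeZero d] (ρ : G →* Matrix (Fin N) (Fin N) ℂ) (i j : Fin d)
    (A κ : ℝ) : Prop :=
  UniformTorusPlaquetteCorr d ρ i j (fun β => ⌈β ^ A⌉₊) (fun β => κ * β ^ (-(2 + 8 * A)))

/-- **KERNEL GLUE: PW-CORR-POLY(A, κ) ⇒ XI-POW(A/2)** (the power-law floor at separation `⌈β^A⌉`, fed to `massGapPowerDecayOf_of_powerLawCorr`). -/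
theorem massGapPowerDecayOf_of_polySeparationFloor [NeZero d] (hρ : Continuous ρ) {i j : Fin d} (hi : i ≠ 0)
    (hj : j ≠ 0) {A κ : ℝ} (hA : 0 < A) (hκ : 0 < κ) (h : PolySeparationPlaquetteFloor d ρ i j A κ) :
    MassGapPowerDecayOf d ρ (A / 2) :=
  massGapPowerDecayOf_of_powerLawCorr ρ hρ hi hj hA hκ h

end Currency

end Summit.QuantumFields.YangMills.Theorems.WeakCouplingRates

end
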